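import Summits.CriticalPhenomena.PercolationContinuityZ3.Theorems.PercNearOneGluingNoHeavyLowerTailSahiCoordinateChord
import Summits.CriticalPhenomena.PercolationContinuityZ3.Theorems.PercNearOneGluingNoHeavyLowerTailSahiCoordinateInduction
import Summits.CriticalPhenomena.PercolationContinuityZ3.Theorems.PercNearOneGluingNoHeavyLowerTailSahiHittingFirstBernstein
import Mathlib.Tactic.Linarith
import Mathlib.Tactic.Ring
import HarnessLib

/-!
# `NoHeavyLowerTail` (crux stmt-CriticalPhenomena-4575), master-family line P2: the one-coordinate BERNSTEIN PIECES `b₁(e), b₂(e)` of `E_3` IN CLOSED FORM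
# (influences, section masses) — the combinatorial face of `DTEGC'` / `DTEGCWeak`

Support file (seat `prim-masterthm-p2`, gen 10; `--supports stmt-CriticalPhenomena-4575`); no definition, no sorry.  Memo SAHI-ROUTE.md §4.32(c),(i),(j).

`SahiCoordinateBernstein.coordPiece₁/₂ p e U` are defined abstractly as `−(c₂+c₃)`, `−(c₂+2c₃)` in the coefficients of the fibre cubic `s ↦ E_3(μ_{p[e↦s]}; U)`;
the typed conjectures `SahiCoordinateInduction.DTEGC'` (∃ e with `b₁, b₂ ≥ 0`) and `DTEGCWeak` (∃ e with `(1−p_e)b₁ + p_e b₂ ≥ 0`) on doubly-terminal triples imply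
Kahn's C_3 (`masterFamilyNonneg_three_of_DTEGCWeak`).  This file computes the pieces: with `X^b = secAt e b X`, `m = μ_p`, `ν_X = m X¹ − m X⁰`,
`ν_{XY} = m(X¹∩Y¹) − m(X⁰∩Y⁰)` and `U = ![A, B, C]`,
* `coordPiece₁_eq`:  **`b₁(e) = Σ_cyc ν_A ν_{BC} − Σ_cyc m(A⁰)·ν_B ν_C − ν_A ν_B ν_C`**;
* `coordPiece₂_eq`:  **`b₂(e) = Σ_cyc ν_A ν_{BC} − Σ_cyc m(A⁰)·ν_B ν_C − 2·ν_A ν_B ν_C`**  (the gen-5 closed form of SAHI-ROUTE §4.16, now in the tree);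
* `coordPieces_mix_eq_chord`: `(1−p_e)b₁ + p_e b₂` is the chord remainder `G_e` of `SahiCoordinateChord.sahiE_three_chord`, so `DTEGCWeak`'s condition at `e` reads
  "`E_3 ≥ (1−p_e)·E_3(sections at 0) + p_e·E_3(sections at 1)`", and (pivotal form, `…chord_pivotal`) its only signed ingredients are the section-vs-pivotal-set
  covariances `Cov(1_{A¹}, 1_{C¹∖C⁰})`.
Proof: compare `SahiCoordinateBernstein.sahiE_three_decomp_coord` with the chord identity at the interior parameter `p[e ↦ ½]` (pieces and section masses do not
depend on `p_e`: `secPoly_update_same`, `ex_ind_secAt_update`) to get `b₁ + b₂`, and use `coordPiece₁_sub_coordPiece₂` (`b₁ − b₂ = ν_Aν_Bν_C`).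
Census status of the conjectures (memo §4.32(d),(h); this generation): `DTEGCWeak` has NO known failure (all 17 / 1,552 doubly-terminal orbits of `2^[4]` / `2^[5]` ×
adversarial `p`, sampled doubly-terminal triples of `2^[6]`, `2^[7]`); the ∃-free chord statement for GENERAL (non-terminal) triples is false (master-conj gen 14, n = 6).
-/

noncomputable section

open scoped Classical

namespace Summit.CriticalPhenomena.PercolationContinuityZ3.Theorems

namespace SahiCoordinateChord

open Finset Function
open Literature.Combinatorics.Sahi2008
open Literature.Probability.Percolation.DecisionTree (ind ind_of_mem ind_of_not_mem ind_nonneg)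
open SahiCombDisjunct
open SahiCoordinateBernstein (coordPiece₁ coordPiece₂ sahiE_three_decomp_coord)
open SahiCoordinateInduction (coordPiece₁_sub_coordPiece₂)
open SahiHittingFirstBernstein (secPoly_update_same)

variable {ι : Type} [Fintype ι] (p : ι → unitInterval) (e : ι) (A B C : Set (Set ι))

/-- The pieces do not depend on `p_e`. [this work] -/
theorem coordPiece₁_update_same (s : unitInterval) :
    coordPiece₁ (update p e s) e ![A, B, C] = coordPiece₁ p e ![A, B, C] := by
  simp only [coordPiece₁, secPoly_update_same]

/-- The pieces do not depend on `p_e`. [this work] -/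
theorem coordPiece₂_update_same (s : unitInterval) :
    coordPiece₂ (update p e s) e ![A, B, C] = coordPiece₂ p e ![A, B, C] := by
  simp only [coordPiece₂, secPoly_update_same]

/-- `b₁ − b₂ = ν_A ν_B ν_C` with the influences written as section masses under `μ_p`. [this work] -/
theorem coordPiece₁_sub_coordPiece₂_ex :
    coordPiece₁ p e ![A, B, C] - coordPiece₂ p e ![A, B, C] =
      (ex (bernoulliWeight p) (ind (secAt e true A)) - ex (bernoulliWeight p) (ind (secAt e false A)))
        * (ex (bernoulliWeight p) (ind (secAt e true B)) - ex (bernoulliWeight p) (ind (secAt e false B)))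
        * (ex (bernoulliWeight p) (ind (secAt e true C)) - ex (bernoulliWeight p) (ind (secAt e false C))) := by
  rw [coordPiece₁_sub_coordPiece₂ p e ![A, B, C], Fin.prod_univ_three]
  simp only [Matrix.cons_val_zero, Matrix.cons_val_one, Matrix.head_cons, Matrix.cons_val_two, Matrix.tail_cons, secEx_ind_eq]

/-- `b₁ + b₂ = 2G_e(½)`: the two decompositions compared at `p[e ↦ ½]`. [this work] -/
theorem coordPiece₁_add_coordPiece₂ :
    coordPiece₁ p e ![A, B, C] + coordPiece₂ p e ![A, B, C] =
      2 * ( ( (ex (bernoulliWeight p) (ind (secAt e true A)) - ex (bernoulliWeight p) (ind (secAt e false A)))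
              * (ex (bernoulliWeight p) (ind (secAt e true B ∩ secAt e true C)) - ex (bernoulliWeight p) (ind (secAt e false B ∩ secAt e false C)))
            + (ex (bernoulliWeight p) (ind (secAt e true B)) - ex (bernoulliWeight p) (ind (secAt e false B)))
              * (ex (bernoulliWeight p) (ind (secAt e true A ∩ secAt e true C)) - ex (bernoulliWeight p) (ind (secAt e false A ∩ secAt e false C)))
            + (ex (bernoulliWeight p) (ind (secAt e true C)) - ex (bernoulliWeight p) (ind (secAt e false C)))
              * (ex (bernoulliWeight p) (ind (secAt e true A ∩ secAt e true B)) - ex (bernoulliWeight p) (ind (secAt e false A ∩ secAt e false B))) )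
          - ( ex (bernoulliWeight p) (ind (secAt e false A))
              * (ex (bernoulliWeight p) (ind (secAt e true B)) - ex (bernoulliWeight p) (ind (secAt e false B)))
              * (ex (bernoulliWeight p) (ind (secAt e true C)) - ex (bernoulliWeight p) (ind (secAt e false C)))
            + ex (bernoulliWeight p) (ind (secAt e false B))
              * (ex (bernoulliWeight p) (ind (secAt e true A)) - ex (bernoulliWeight p) (ind (secAt e false A)))
              * (ex (bernoulliWeight p) (ind (secAt e true C)) - ex (bernoulliWeight p) (ind (secAt e false C)))
            + ex (bernoulliWeight p) (ind (secAt e false C))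
              * (ex (bernoulliWeight p) (ind (secAt e true A)) - ex (bernoulliWeight p) (ind (secAt e false A)))
              * (ex (bernoulliWeight p) (ind (secAt e true B)) - ex (bernoulliWeight p) (ind (secAt e false B))) ) )
      - 3 * ( (ex (bernoulliWeight p) (ind (secAt e true A)) - ex (bernoulliWeight p) (ind (secAt e false A)))
              * (ex (bernoulliWeight p) (ind (secAt e true B)) - ex (bernoulliWeight p) (ind (secAt e false B)))
              * (ex (bernoulliWeight p) (ind (secAt e true C)) - ex (bernoulliWeight p) (ind (secAt e false C))) ) := by
  have hhalf : (1 / 2 : ℝ) ∈ Set.Icc (0 : ℝ) 1 := by constructor <;> norm_num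
  have hqe : ((update p e (⟨1 / 2, hhalf⟩ : unitInterval) e : unitInterval) : ℝ) = 1 / 2 := by
    rw [update_self]
  -- the tree's Bernstein decomposition at `p[e ↦ ½]`
  have h1 := sahiE_three_decomp_coord (update p e ⟨1 / 2, hhalf⟩) e ![A, B, C]
  have hfun : (fun j => ind ((![A, B, C] : Fin 3 → Set (Set ι)) j)) = ![ind A, ind B, ind C] := by
    funext j; fin_cases j <;> rfl
  have hfun0 : (fun j => ind (secAt e false ((![A, B, C] : Fin 3 → Set (Set ι)) j))) =
      ![ind (secAt e false A), ind (secAt e false B), ind (secAt e false C)] := by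
    funext j; fin_cases j <;> rfl
  have hfun1 : (fun j => ind (secAt e true ((![A, B, C] : Fin 3 → Set (Set ι)) j))) =
      ![ind (secAt e true A), ind (secAt e true B), ind (secAt e true C)] := by
    funext j; fin_cases j <;> rfl
  simp only [hfun, hfun0, hfun1, coordPiece₁_update_same, coordPiece₂_update_same, hqe] at h1
  -- the chord identity at `p[e ↦ ½]`, with section masses rewritten under `p`
  have h2 := sahiE_three_chord (update p e ⟨1 / 2, hhalf⟩) e A B C
  simp only [hqe] at h2
  simp only [← secAt_inter] at h2
  simp only [ex_ind_secAt_update] at h2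
  simp only [secAt_inter] at h2
  -- eliminate E_3 and the two sectional E_3's
  linear_combination (-8 : ℝ) * h1 + 8 * h2

/-- **THE FIRST BERNSTEIN PIECE IN CLOSED FORM**: `b₁(e) = Σ_cyc ν_A ν_{BC} − Σ_cyc m(A⁰)·ν_B ν_C − ν_A ν_B ν_C`. [this work] -/
theorem coordPiece₁_eq :
    coordPiece₁ p e ![A, B, C] =
      ( (ex (bernoulliWeight p) (ind (secAt e true A)) - ex (bernoulliWeight p) (ind (secAt e false A)))
          * (ex (bernoulliWeight p) (ind (secAt e true B ∩ secAt e true C)) - ex (bernoulliWeight p) (ind (secAt e false B ∩ secAt e false C)))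
        + (ex (bernoulliWeight p) (ind (secAt e true B)) - ex (bernoulliWeight p) (ind (secAt e false B)))
          * (ex (bernoulliWeight p) (ind (secAt e true A ∩ secAt e true C)) - ex (bernoulliWeight p) (ind (secAt e false A ∩ secAt e false C)))
        + (ex (bernoulliWeight p) (ind (secAt e true C)) - ex (bernoulliWeight p) (ind (secAt e false C)))
          * (ex (bernoulliWeight p) (ind (secAt e true A ∩ secAt e true B)) - ex (bernoulliWeight p) (ind (secAt e false A ∩ secAt e false B))) )
      - ( ex (bernoulliWeight p) (ind (secAt e false A))
          * (ex (bernoulliWeight p) (ind (secAt e true B)) - ex (bernoulliWeight p) (ind (secAt e false B)))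
          * (ex (bernoulliWeight p) (ind (secAt e true C)) - ex (bernoulliWeight p) (ind (secAt e false C)))
        + ex (bernoulliWeight p) (ind (secAt e false B))
          * (ex (bernoulliWeight p) (ind (secAt e true A)) - ex (bernoulliWeight p) (ind (secAt e false A)))
          * (ex (bernoulliWeight p) (ind (secAt e true C)) - ex (bernoulliWeight p) (ind (secAt e false C)))
        + ex (bernoulliWeight p) (ind (secAt e false C))
          * (ex (bernoulliWeight p) (ind (secAt e true A)) - ex (bernoulliWeight p) (ind (secAt e false A)))
          * (ex (bernoulliWeight p) (ind (secAt e true B)) - ex (bernoulliWeight p) (ind (secAt e false B))) )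
      - (ex (bernoulliWeight p) (ind (secAt e true A)) - ex (bernoulliWeight p) (ind (secAt e false A)))
          * (ex (bernoulliWeight p) (ind (secAt e true B)) - ex (bernoulliWeight p) (ind (secAt e false B)))
          * (ex (bernoulliWeight p) (ind (secAt e true C)) - ex (bernoulliWeight p) (ind (secAt e false C))) := by
  have hs := coordPiece₁_sub_coordPiece₂_ex p e A B C
  have ha := coordPiece₁_add_coordPiece₂ p e A B C
  linear_combination (1 / 2 : ℝ) * hs + (1 / 2 : ℝ) * ha

/-- **THE SECOND BERNSTEIN PIECE IN CLOSED FORM**: `b₂(e) = Σ_cyc ν_A ν_{BC} − Σ_cyc m(A⁰)·ν_B ν_C − 2·ν_A ν_B ν_C`. [this work] -/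
theorem coordPiece₂_eq :
    coordPiece₂ p e ![A, B, C] =
      ( (ex (bernoulliWeight p) (ind (secAt e true A)) - ex (bernoulliWeight p) (ind (secAt e false A)))
          * (ex (bernoulliWeight p) (ind (secAt e true B ∩ secAt e true C)) - ex (bernoulliWeight p) (ind (secAt e false B ∩ secAt e false C)))
        + (ex (bernoulliWeight p) (ind (secAt e true B)) - ex (bernoulliWeight p) (ind (secAt e false B)))
          * (ex (bernoulliWeight p) (ind (secAt e true A ∩ secAt e true C)) - ex (bernoulliWeight p) (ind (secAt e false A ∩ secAt e false C)))
        + (ex (bernoulliWeight p) (ind (secAt e true C)) - ex (bernoulliWeight p) (ind (secAt e false C)))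
          * (ex (bernoulliWeight p) (ind (secAt e true A ∩ secAt e true B)) - ex (bernoulliWeight p) (ind (secAt e false A ∩ secAt e false B))) )
      - ( ex (bernoulliWeight p) (ind (secAt e false A))
          * (ex (bernoulliWeight p) (ind (secAt e true B)) - ex (bernoulliWeight p) (ind (secAt e false B)))
          * (ex (bernoulliWeight p) (ind (secAt e true C)) - ex (bernoulliWeight p) (ind (secAt e false C)))
        + ex (bernoulliWeight p) (ind (secAt e false B))
          * (ex (bernoulliWeight p) (ind (secAt e true A)) - ex (bernoulliWeight p) (ind (secAt e false A)))
          * (ex (bernoulliWeight p) (ind (secAt e true C)) - ex (bernoulliWeight p) (ind (secAt e false C)))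
        + ex (bernoulliWeight p) (ind (secAt e false C))
          * (ex (bernoulliWeight p) (ind (secAt e true A)) - ex (bernoulliWeight p) (ind (secAt e false A)))
          * (ex (bernoulliWeight p) (ind (secAt e true B)) - ex (bernoulliWeight p) (ind (secAt e false B))) )
      - 2 * ((ex (bernoulliWeight p) (ind (secAt e true A)) - ex (bernoulliWeight p) (ind (secAt e false A)))
          * (ex (bernoulliWeight p) (ind (secAt e true B)) - ex (bernoulliWeight p) (ind (secAt e false B)))
          * (ex (bernoulliWeight p) (ind (secAt e true C)) - ex (bernoulliWeight p) (ind (secAt e false C)))) := by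
  have hs := coordPiece₁_sub_coordPiece₂_ex p e A B C
  have ha := coordPiece₁_add_coordPiece₂ p e A B C
  linear_combination (1 / 2 : ℝ) * ha - (1 / 2 : ℝ) * hs

/-- **`DTEGCWeak`'s quantity is the chord remainder**: `(1−p_e)·b₁(e) + p_e·b₂(e) = G_e` (influence form of `sahiE_three_chord`). [this work] -/
theorem coordPieces_mix_eq_chord :
    (1 - (p e : ℝ)) * coordPiece₁ p e ![A, B, C] + (p e : ℝ) * coordPiece₂ p e ![A, B, C] =
      ( ( (ex (bernoulliWeight p) (ind (secAt e true A)) - ex (bernoulliWeight p) (ind (secAt e false A)))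
              * (ex (bernoulliWeight p) (ind (secAt e true B ∩ secAt e true C)) - ex (bernoulliWeight p) (ind (secAt e false B ∩ secAt e false C)))
            + (ex (bernoulliWeight p) (ind (secAt e true B)) - ex (bernoulliWeight p) (ind (secAt e false B)))
              * (ex (bernoulliWeight p) (ind (secAt e true A ∩ secAt e true C)) - ex (bernoulliWeight p) (ind (secAt e false A ∩ secAt e false C)))
            + (ex (bernoulliWeight p) (ind (secAt e true C)) - ex (bernoulliWeight p) (ind (secAt e false C)))
              * (ex (bernoulliWeight p) (ind (secAt e true A ∩ secAt e true B)) - ex (bernoulliWeight p) (ind (secAt e false A ∩ secAt e false B))) )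
          - ( ((p e : ℝ) * ex (bernoulliWeight p) (ind (secAt e true A)) + (1 - (p e : ℝ)) * ex (bernoulliWeight p) (ind (secAt e false A)))
              * (ex (bernoulliWeight p) (ind (secAt e true B)) - ex (bernoulliWeight p) (ind (secAt e false B)))
              * (ex (bernoulliWeight p) (ind (secAt e true C)) - ex (bernoulliWeight p) (ind (secAt e false C)))
            + ((p e : ℝ) * ex (bernoulliWeight p) (ind (secAt e true B)) + (1 - (p e : ℝ)) * ex (bernoulliWeight p) (ind (secAt e false B)))
              * (ex (bernoulliWeight p) (ind (secAt e true A)) - ex (bernoulliWeight p) (ind (secAt e false A)))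
              * (ex (bernoulliWeight p) (ind (secAt e true C)) - ex (bernoulliWeight p) (ind (secAt e false C)))
            + ((p e : ℝ) * ex (bernoulliWeight p) (ind (secAt e true C)) + (1 - (p e : ℝ)) * ex (bernoulliWeight p) (ind (secAt e false C)))
              * (ex (bernoulliWeight p) (ind (secAt e true A)) - ex (bernoulliWeight p) (ind (secAt e false A)))
              * (ex (bernoulliWeight p) (ind (secAt e true B)) - ex (bernoulliWeight p) (ind (secAt e false B))) )
          - ((1 - (p e : ℝ)) - (p e : ℝ))
              * (ex (bernoulliWeight p) (ind (secAt e true A)) - ex (bernoulliWeight p) (ind (secAt e false A)))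
              * (ex (bernoulliWeight p) (ind (secAt e true B)) - ex (bernoulliWeight p) (ind (secAt e false B)))
              * (ex (bernoulliWeight p) (ind (secAt e true C)) - ex (bernoulliWeight p) (ind (secAt e false C))) ) := by
  rw [coordPiece₁_eq, coordPiece₂_eq]
  ring

/-- **`DTEGCWeak`'s condition at `e` gives the local step**: `(1−p_e)b₁ + p_e b₂ ≥ 0 ⇒ E_3 ≥ (1−p_e)·E_3(sections at 0) + p_e·E_3(sections at 1)`;
conversely, for `0 < p_e < 1`, the local-step inequality gives back `(1−p_e)b₁ + p_e b₂ ≥ 0`. [this work] -/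
theorem sections_le_of_coordPieces_mix_nonneg
    (h : 0 ≤ (1 - (p e : ℝ)) * coordPiece₁ p e ![A, B, C] + (p e : ℝ) * coordPiece₂ p e ![A, B, C]) :
    (1 - (p e : ℝ)) * sahiE (bernoulliWeight p) 3 ![ind (secAt e false A), ind (secAt e false B), ind (secAt e false C)]
      + (p e : ℝ) * sahiE (bernoulliWeight p) 3 ![ind (secAt e true A), ind (secAt e true B), ind (secAt e true C)]
      ≤ sahiE (bernoulliWeight p) 3 ![ind A, ind B, ind C] := by
  apply sahiE_three_ge_sections_of_chord p e A B C
  rw [← coordPieces_mix_eq_chord]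
  exact h

/-- Converse at an interior parameter. [this work] -/
theorem coordPieces_mix_nonneg_of_sections_le (hp0 : 0 < (p e : ℝ)) (hp1 : (p e : ℝ) < 1)
    (h : (1 - (p e : ℝ)) * sahiE (bernoulliWeight p) 3 ![ind (secAt e false A), ind (secAt e false B), ind (secAt e false C)]
      + (p e : ℝ) * sahiE (bernoulliWeight p) 3 ![ind (secAt e true A), ind (secAt e true B), ind (secAt e true C)]
      ≤ sahiE (bernoulliWeight p) 3 ![ind A, ind B, ind C]) :
    0 ≤ (1 - (p e : ℝ)) * coordPiece₁ p e ![A, B, C] + (p e : ℝ) * coordPiece₂ p e ![A, B, C] := by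
  have hc := sahiE_three_chord p e A B C
  rw [← coordPieces_mix_eq_chord] at hc
  have hpos : 0 < (p e : ℝ) * (1 - (p e : ℝ)) := mul_pos hp0 (by linarith)
  by_contra hneg
  rw [not_le] at hneg
  have : (p e : ℝ) * (1 - (p e : ℝ)) * ((1 - (p e : ℝ)) * coordPiece₁ p e ![A, B, C] + (p e : ℝ) * coordPiece₂ p e ![A, B, C]) < 0 :=
    mul_neg_of_pos_of_neg hpos hneg
  linarith

end SahiCoordinateChord

end Summit.CriticalPhenomena.PercolationContinuityZ3.Theorems
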